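import Literature.MathematicalPhysics.QuantumFieldTheory.Balaban1983to89.B9Thm37GlueCor36
import Literature.MathematicalPhysics.QuantumFieldTheory.Balaban1983to89.B9Ineq347GAAtLetters
import Literature.MathematicalPhysics.QuantumFieldTheory.Balaban1983to89.Node00.OpsYDeltaA

/-!
# `Balaban1983to89.B9CoRealizesSharedBlock` — the (3.42) CO-READING `CoRealizes` of G(1) is REFUTED at every member whose domain datum has two
# index bonds with one carrier block (every member of dimension ≥ 2): the record's «sites = index bonds» reading against the block fibres

T. Bałaban, *Propagators for lattice gauge theories in a background field*, Commun. Math. Phys. **99** (1985) 389–434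
[`Balaban1985BackgroundPropagators`, "B9"]; [4] = T. Bałaban, *Propagators and renormalization transformations for lattice gauge
theories. II*, Commun. Math. Phys. **96** (1984) 223–250 [`Balaban1984PropagatorsII`].

statement-level skeleton of published theorems with citation tags; proofs where landed; nothing here is a claim about the
Yang–Mills mass gap

THE PRINTED LOCI.  (3.42) p. 397 *"for x ∈ Δ(y), y ∈ Λ_j, supp λ ⊂ Δ(y′)"* — y, y′ range over 𝔅 = ⋃_j Λ_j, the BLOCKS ([4] (2.45) p. 231); [4] (2.3)
p. 224 *"Λ_j also denotes the set of bonds with at least one end-point in Λ_j"*; Cor. 3.5 p. 407 (U = 1 is [4]); [4] p. 228 *"The operator G is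
positive"*, (2.22) p. 226 *"G = Δ_a⁻¹"*.

THE POINT (a located NEGATIVE about the RECORD'S READING, sequel of `B9GlobReadingOrphan`; not about print).  The (3.42) members of the N06 knit
are fed through n06-c's co-reading `B9Thm37GlueCor36.CoRealizes K n U bu bv ev A` (binders `hco…` of rows 18–21 and of t37): `off` — if the
argument λ is supported in Δ(y′) then its evaluation `ev λ` on the model lattice lives in the fibre `bv⁻¹(y′)`; `obs` — the reading `K.e n U λ y`
is below every bound of |A(ev λ)| on the fibre `bu⁻¹(y)`.  At the geometry of record the «sites» y are the INDEX BONDS and Δ(y) is the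
CARRIER BLOCK `β y`; as soon as two index bonds `c′ ≠ c″` have the same carrier block (`β c′ = β c″` — e.g. the bonds ⟨y₀, y₀ + e₀⟩, ⟨y₀, y₀ + e₁⟩
at a site y₀ of the top attained level, where nothing is deep: EVERY member of dimension d + 1 ≥ 2, §2), an argument λ = J ⊗ · with J supported
in that block is «supported in Δ(c′)» AND «in Δ(c″)», so `off` forces `ev λ` into `bv⁻¹(c′) ∩ bv⁻¹(c″) = ∅`, i.e. `ev λ = 0`; then `obs` at c = 0
forces the reading `K.e 0 U λ c′ ≤ 0`.  For G(1) this is FALSE for every letter record: def-Y's clause `CovLettersY.GA_one` pins G(1)(J ⊗ E) =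
(Δ_a⁻¹J) ⊗ E, and Δ_a⁻¹ is positive ([4] p. 228, `B6SectAVectorModelV1.inner_GE_pos`): with J = 𝟙_{x₀}, x₀ a fine bond of the block,
(Δ_a⁻¹J)(x₀) = ⟨𝟙_{x₀}, Δ_a⁻¹𝟙_{x₀}⟩ > 0, so the reading on `β c′` is positive.
* §1 ★ `not_coRealizes_GA_one_of_sharedBlock` — for EVERY `𝔏 : CovLettersY 𝔸 x` (𝔸 nontrivial), `𝔈`, every model lattices `u v`, block maps
  `bu bv`, evaluation `ev` and model operator `A`: two distinct index bonds with a common carrier block containing a fine bond ⇒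
  `¬ CoRealizes (operatorLayerYOfLetters 𝔸 G x 𝔏 𝔈).GA 0 (bg9Y 𝔸 G x).one bu bv ev A`.
* §2 ★ `exists_sharedBlock` — such a pair exists at every k-level V1 index with d ≥ 1 (two lattice directions): at a fine site x⋆ of maximal
  level j nothing of level j is deep, and ⟨y₀, y₀ + e₀⟩, ⟨y₀, y₀ + e₁⟩ (y₀ the j-block of x⋆) are index bonds based at y₀.
* §3 ★★ `not_hcoGA_opsYOfLetters` — at the record (`N ≥ 1`, `1 ≤ θ.d₆`): for every member x, every `𝔏 𝔈`, every `u v bu bv ev A`,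
  `¬ CoRealizes ((opsYOfLetters N θ M⋆ 𝔏 𝔈) x).GA 0 1 bu bv ev A` — every knit binder of the shape `∀ x U, CoRealizes ((ops x).GA) 0 U …` is
  UNSATISFIABLE at `ops := opsYOfLetters …` (and at `opsYOfRecord`).
CONSEQUENCE FOR THE CELL.  The (3.42) co-reading currency needs the same repair as the (3.47) one (`B9Ineq347CoReading`): the model side must read
BLOCKS, not fibres of index bonds — either a block-sited geometry for the sup entries (memo `ORPHAN-BLOCKS-MEMO.md` R2) or a co-reading whose `off`∕`obs`
speak of «same carrier block» instead of «equal site».  Nothing landed is false; the affected objects are displayed hypotheses.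

CLASS AND REPAIRED BINDER C′ (dag-lead WORDS-132 (3)).  MISSTATED, not substantive: the schema models print's «x ∈ Δ(y)» ∕ «supp λ ⊂ Δ(y′)» by EQUALITY
of sites (`bu x = y`, `bv x′ = y′`) at a geometry where several sites (index bonds) have ONE Δ (carrier block).  C′ := the same co-reading RELATIVE TO THE
CARRIER-BLOCK EQUIVALENCE `R c c′ :↔ β c = β c′` — `off′ : suppIn λ y′ → ∀ x′, ¬ R (bv x′) y′ → ev λ x′ = 0` (the evaluation lives on the UNION of the fibres of
the index bonds of the block — the witness 𝟙_{x₀} ⊗ · then keeps `ev λ = 𝟙_{x₀}` on that union and nothing is forced to vanish), `obs′ : (∀ x, R (bu x) y →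
|(A(ev λ))(x)| ≦ c) → K.e n U λ y ≦ c`, with the model majorant R-saturated (constant on R-classes, as `maj342` is: it depends on the level and the
distance of the carrier blocks only); the consumer lemma then splits `ev λ` into the ≦ 2(d+1) fibre pieces of one block ([4] (2.52)), so the (3.42)
constant picks up the multiplicity factor 2(d+1) — a cheap repair.  Generic form: parametrize `CoRealizes` (and `L2Reads`, `H1Reads`, `InputReads`) by an
equivalence relation on `g.Site` (equality recovers the landed schema); at `geo9K` take `R := (β · = β ·)`.  Equivalent and cleaner: R2 (block-sited reading).

HONEST SCOPE.  A negative about a displayed HYPOTHESIS SCHEMA of the cell at the record's reading, plus lattice combinatorics of the tree's own domain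
datum; nothing of [B9] or [4] asserted or denied (print's y, y′ are blocks, where no fibre phenomenon exists); count-neutral; N06 NOT discharged; one
finite lattice programme — nothing continuum, nothing about the mass gap.  Cell `pub-ymgap` (HUMAN RULING D-0062), Track A node N06 [B9], seat
`pub-ymgap-dag-n06-l` (g3), 2026-08-27.
-/

noncomputable section

namespace Literature.MathematicalPhysics.QuantumFieldTheory.Balaban1983to89.B9CoRealizesSharedBlock

open LatticeFieldCalculus
open B5Eq118OneStroke (iterBlockOf iterBlock mem_iterBlock iterBlockOf_zero iterBlockOf_succ)
open B6MultiLevelBoxOperator (N0 Domains)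
open B6MultiLevelTorusOperator (TDomains)
open B6SectAOperatorsV1 (BondIdx inner_eq_sum)
open B6SectAVectorModelV1 (GE inner_GE_pos)
open B6GlobalChartV1 (PV toBox domT blkV1 iterBlockOf_mem_domT_iff)
open B6Ineq2142KLevelV1 (β lvl base blkV1_eq_beta)
open B6KLevelCensusIndexV1 (KIdx)
open B6AgreeQaQV1Chart (iterBlock_nonempty)
open B6Ineq2133TwoScaleV1 (onFun onFun_apply)
open B6Prop26Census2136KLevelV1 (Gop supIn)
open B9Thm37GlueCor36 (CoRealizes)
open B9Cor35ComparisonsGAAtLetters (supInB_liftY_le)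
open B9PinMembersKLevelV1 (MemberY geo9Y bg9Y)
open B7Prop2SpecialUnitary (specialUnitaryUnits)
open Node00 (SiteY FBondY BlkY IBondY CfgY BallY liftY liftY_apply norm_liftY_le supInB kernelFamilyB CovLettersY ExpLettersY
  operatorLayerYOfLetters LettersY ExpsY opsYOfLetters opsYOfRecord Stage3Params)
open scoped Matrix InnerProductSpace

variable {d ℓ : ℕ} {hd : 1 ≤ d + 1} {hL : Odd (ℓ + 1) ∧ 1 < ℓ + 1} {b₀ b₁ : ℝ} {Mstar : ℕ}
variable {𝔸 : Type} [NormedRing 𝔸] [NormedAlgebra ℂ 𝔸] [CompleteSpace 𝔸]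

/-! ## §1 ★ Two index bonds with one carrier block refute `CoRealizes` of G(1), for every letter record -/

section Member

/-- **`(Δ_a⁻¹ 𝟙_{x₀})(x₀) > 0`** — r03's genuine `Gop = Δ_a⁻¹` is positive ([4] p. 228 *"The operator G is positive"*): the diagonal entry of the
inverse is `⟨𝟙_{x₀}, Δ_a⁻¹𝟙_{x₀}⟩ > 0`. [cite: Balaban1984PropagatorsII, p.228 + (2.22) p.226] -/
theorem Gop_indicator_self_pos (i : KIdx d ℓ hd hL b₀ b₁) (x₀ : FBondY i) :
    0 < Gop i (fun x => if x = x₀ then (1 : ℝ) else 0) x₀ := by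
  classical
  set J : FBondY i → ℝ := fun x => if x = x₀ then (1 : ℝ) else 0 with hJ
  have hu : (WithLp.toLp 2 J : EuclideanSpace ℝ (FBondY i)) ≠ 0 := by
    intro h
    have h1 : (WithLp.toLp 2 J : EuclideanSpace ℝ (FBondY i)) x₀ = 0 := by rw [h]; rfl
    simp [hJ] at h1
  have hpos := inner_GE_pos (domT i.hN i.D i.hk) i.hcf i.hw hu
  rw [inner_eq_sum] at hpos
  have hsum : ∑ x, (WithLp.toLp 2 J : EuclideanSpace ℝ (FBondY i)) x * (GE (domT i.hN i.D i.hk) i.hcf i.hw (WithLp.toLp 2 J)) x =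
      (GE (domT i.hN i.D i.hk) i.hcf i.hw (WithLp.toLp 2 J)) x₀ := by
    have : ∀ x, (WithLp.toLp 2 J : EuclideanSpace ℝ (FBondY i)) x * (GE (domT i.hN i.D i.hk) i.hcf i.hw (WithLp.toLp 2 J)) x =
        if x = x₀ then (GE (domT i.hN i.D i.hk) i.hcf i.hw (WithLp.toLp 2 J)) x₀ else 0 := by
      intro x
      by_cases hx : x = x₀
      · subst hx; simp [hJ]
      · simp [hJ, hx]
    rw [Finset.sum_congr rfl fun x _ => this x, Finset.sum_ite_eq' Finset.univ x₀]
    simp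
  rw [hsum] at hpos
  exact hpos

variable [Nontrivial 𝔸] {G : Subgroup 𝔸ˣ}
variable (x : MemberY d ℓ hd hL b₀ b₁ Mstar) (𝔏 : CovLettersY 𝔸 x) (𝔈 : ExpLettersY 𝔸 G x)

omit [CompleteSpace 𝔸] in
/-- the unit direction `‖1‖⁻¹·1` lies in the ball. [cite: Balaban1985BackgroundPropagators, (3.39) p.397, bookkeeping] -/
private theorem unitDir_mem : ((‖(1 : 𝔸)‖⁻¹ : ℝ) : ℂ) • (1 : 𝔸) ∈ Metric.closedBall (0 : 𝔸) 1 := by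
  have h1 : 0 < ‖(1 : 𝔸)‖ := norm_pos_iff.mpr one_ne_zero
  rw [mem_closedBall_zero_iff, norm_smul, Complex.norm_real, Real.norm_eq_abs, abs_of_pos (inv_pos.mpr h1), inv_mul_cancel₀ h1.ne']

omit [CompleteSpace 𝔸] in
/-- the unit direction has norm one. [cite: Balaban1985BackgroundPropagators, (3.39) p.397, bookkeeping] -/
private theorem norm_unitDir : ‖((‖(1 : 𝔸)‖⁻¹ : ℝ) : ℂ) • (1 : 𝔸)‖ = 1 := by
  have h1 : 0 < ‖(1 : 𝔸)‖ := norm_pos_iff.mpr one_ne_zero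
  rw [norm_smul, Complex.norm_real, Real.norm_eq_abs, abs_of_pos (inv_pos.mpr h1), inv_mul_cancel₀ h1.ne']

/-- ★ **TWO INDEX BONDS WITH ONE CARRIER BLOCK REFUTE THE (3.42) CO-READING OF G(1), FOR EVERY LETTER RECORD.**  If the index bonds `c′ ≠ c″` have
the same carrier block and `x₀` is a fine bond of it, then for every `𝔏 : CovLettersY 𝔸 x` (printed clause `GA_one`), every `𝔈`, every model lattices
`u v`, block maps `bu bv`, evaluation `ev` and model operator `A`: `¬ CoRealizes (operatorLayerYOfLetters 𝔸 G x 𝔏 𝔈).GA 0 1 bu bv ev A`.  Proof: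
λ := 𝟙_{x₀} ⊗ · is supported in Δ(c′) = Δ(c″), so `off` at c′ and at c″ kills `ev λ` everywhere (no point lies in both fibres); `obs` at (c′, 0) then
gives `GA.e 0 1 λ c′ ≤ 0`, whereas by `GA_one` and the positivity of Δ_a⁻¹ the reading is `≥ ‖(Δ_a⁻¹𝟙_{x₀})(x₀)·E₀‖ > 0` at the unit direction E₀.
[cite: Balaban1985BackgroundPropagators, (3.42) p.397 + Cor. 3.5 p.407; Balaban1984PropagatorsII, (2.3) p.224 + (2.22) p.226 + p.228] -/
theorem not_coRealizes_GA_one_of_sharedBlock {c' c'' : IBondY x.toKIdx} (hne : c' ≠ c'')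
    (hβ : β x.hN x.D x.hk c' = β x.hN x.D x.hk c'') {x₀ : FBondY x.toKIdx} (hx₀ : blkV1 x.hN x.D x₀ = β x.hN x.D x.hk c')
    {u v : Type} (bu : u → (geo9Y x).Site) (bv : v → (geo9Y x).Site) (ev : (geo9Y x).Loc → v → ℝ) (A : (v → ℝ) →ₗ[ℝ] (u → ℝ)) :
    ¬ CoRealizes (operatorLayerYOfLetters 𝔸 G x 𝔏 𝔈).GA 0 (bg9Y 𝔸 G x).one bu bv ev A := by
  classical
  intro hC
  -- the argument 𝟙_{x₀}, supported in the common carrier block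
  set J : FBondY x.toKIdx → ℝ := fun b => if b = x₀ then (1 : ℝ) else 0 with hJdef
  have hsupp : ∀ c : IBondY x.toKIdx, β x.hN x.D x.hk c = β x.hN x.D x.hk c' →
      (geo9Y x).suppIn (Sum.inr J : (geo9Y x).Loc) c := by
    intro c hc b hb
    have hb0 : b = x₀ := by
      by_contra h
      exact hb (by simp [hJdef, h])
    subst hb0
    show blkV1 x.hN x.D b = β x.hN x.D x.hk c
    rw [hx₀, hc]
  -- `off` at c′ and at c″ ⇒ ev λ = 0
  have hev : ev (Sum.inr J) = 0 := by
    funext x'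
    by_cases h' : bv x' = c'
    · exact hC.off (Sum.inr J) c'' (hsupp c'' hβ.symm) x' (by rw [h']; exact hne)
    · exact hC.off (Sum.inr J) c' (hsupp c' rfl) x' h'
  -- `obs` at (c′, 0): the reading vanishes
  have hle : (operatorLayerYOfLetters 𝔸 G x 𝔏 𝔈).GA.e 0 (bg9Y 𝔸 G x).one (Sum.inr J) c' ≤ 0 :=
    hC.obs (Sum.inr J) c' 0 le_rfl fun x'' _ => by rw [hev, map_zero, Pi.zero_apply, abs_zero]
  -- but it is positive: `GA_one`, Δ_a⁻¹ > 0 at the diagonal, the unit direction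
  set K : FBondY x.toKIdx → ℝ := Gop x.toKIdx J with hKdef
  have hKpos : 0 < K x₀ := Gop_indicator_self_pos x.toKIdx x₀
  set E₀ : BallY 𝔸 := ⟨((‖(1 : 𝔸)‖⁻¹ : ℝ) : ℂ) • (1 : 𝔸), unitDir_mem⟩ with hE₀def
  set F : BallY 𝔸 → ℝ := fun E => supInB x.toKIdx (β x.hN x.D x.hk c') (𝔏.GA (fun _ _ => 1) (liftY J (E : 𝔸))) with hFdef
  have hFeq : ∀ E : BallY 𝔸, F E = supInB x.toKIdx (β x.hN x.D x.hk c') (liftY K (E : 𝔸)) := by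
    intro E; simp only [hFdef]; rw [𝔏.GA_one]
  have hread : (operatorLayerYOfLetters 𝔸 G x 𝔏 𝔈).GA.e 0 (bg9Y 𝔸 G x).one (Sum.inr J) c' = ⨆ E : BallY 𝔸, F E := by
    show (⨆ E : BallY 𝔸, ((![supInB x.toKIdx (β x.hN x.D x.hk c') (𝔏.GA (fun _ _ => 1) (liftY J (E : 𝔸))),
        ⨆ ν : Fin (d + 1), supInB x.toKIdx (β x.hN x.D x.hk c') (Node00.cdB x.toKIdx (fun _ _ => 1) ν (𝔏.GA (fun _ _ => 1) (liftY J (E : 𝔸)))),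
        ⨆ ν : Fin (d + 1), supInB x.toKIdx (β x.hN x.D x.hk c') (𝔏.GA (fun _ _ => 1) (Node00.cdsB x.toKIdx (fun _ _ => 1) ν (liftY J (E : 𝔸)))),
        supInB x.toKIdx (β x.hN x.D x.hk c') (Node00.lapB x.toKIdx (fun _ _ => 1) (𝔏.GA (fun _ _ => 1) (liftY J (E : 𝔸))))] : Fin 4 → ℝ) 0)) = _
    refine iSup_congr fun E => ?_
    simp only [Matrix.cons_val_zero, hFdef]
  have hbdd : BddAbove (Set.range F) := by
    refine ⟨supIn x.toKIdx (β x.hN x.D x.hk c') K, ?_⟩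
    rintro _ ⟨E, rfl⟩
    rw [hFeq]
    exact supInB_liftY_le x.toKIdx _ K E
  -- the inner sup over the fine bonds of the block, at x₀
  have hinner : ‖liftY K (E₀ : 𝔸) x₀‖ ≤ F E₀ := by
    rw [hFeq]
    unfold supInB
    exact le_ciSup (f := fun b : {b : FBondY x.toKIdx // blkV1 x.hN x.D b = β x.hN x.D x.hk c'} => ‖liftY K (E₀ : 𝔸) b.1‖)
      (Set.finite_range _).bddAbove ⟨x₀, hx₀⟩
  have hval : ‖liftY K (E₀ : 𝔸) x₀‖ = K x₀ := by
    rw [liftY_apply, norm_smul, Complex.norm_real, Real.norm_eq_abs, abs_of_pos hKpos, hE₀def]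
    simp only
    rw [norm_unitDir, mul_one]
  have h0 : 0 < F E₀ := by
    rw [← hval] at hKpos
    exact lt_of_lt_of_le hKpos hinner
  have hpos : 0 < ⨆ E : BallY 𝔸, F E := lt_of_lt_of_le h0 (le_ciSup hbdd E₀)
  rw [hread] at hle
  linarith

end Member

/-! ## §2 ★ Every member of dimension ≥ 2 has two index bonds with one carrier block -/

section Exists

variable {m K : ℕ} {Mh k R : ℕ} {P' : Fin (d + 1) → ℕ}
variable (hN : ∀ μ, N0 ℓ Mh k P' μ = (PV d ℓ m K hd hL).sitesPerDir 0) (D : TDomains d ℓ Mh k P' R) (hk : k ≤ m + K)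

/-- ★ **TWO DISTINCT INDEX BONDS WITH ONE CARRIER BLOCK CONTAINING A FINE BOND EXIST** whenever the lattice has two directions (`1 ≤ d`) and `1 ≤ k`:
at a fine site `x⋆` of MAXIMAL level j nothing of level j is deep (a deep j-block would carry fine sites of level ≥ j + 1), the j-block y₀ of x⋆ lies in
Ω_j^{(j)}, so ⟨y₀, y₀ + e₀⟩ and ⟨y₀, y₀ + e₁⟩ are index bonds based at y₀ — both with carrier block = the block of x⋆ (`blkV1_eq_beta`).
[cite: Balaban1984PropagatorsII, (2.3)–(2.4) p.224 + (2.45) p.231] -/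
theorem exists_sharedBlock (hd1 : 1 ≤ d) (hk1 : 1 ≤ k) :
    ∃ (c' c'' : BondIdx (domT hN D hk)) (x₀ : PBond (PV d ℓ m K hd hL) 0),
      c' ≠ c'' ∧ β hN D hk c' = β hN D hk c'' ∧ blkV1 hN D x₀ = β hN D hk c' := by
  classical
  -- a fine site of maximal level
  obtain ⟨xs, -, hmax⟩ := Finset.exists_max_image (Finset.univ : Finset (Site (PV d ℓ m K hd hL) 0))
    (fun x => D.lev (toBox hN x).1) Finset.univ_nonempty
  set j := D.lev (toBox hN xs).1 with hjdef
  have hj1 : 1 ≤ j := D.one_le_lev _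
  have hjk : j ≤ k := D.lev_le _
  set y₀ : Site (PV d ℓ m K hd hL) j := iterBlockOf j xs with hy₀
  have hOm : y₀ ∈ (domT hN D hk).Om j := (iterBlockOf_mem_domT_iff hN D hk hj1 hjk xs).2 le_rfl
  -- nothing of level j is deep
  have hnd : ∀ y : Site (PV d ℓ m K hd hL) j, ¬ (domT hN D hk).Deep j y := by
    intro y
    by_cases htop : j = k
    · exact (domT hN D hk).not_deep_of_le (show k ≤ j by omega) y
    · have hjk' : j + 1 ≤ k := by omega
      obtain ⟨x'', hx''⟩ := iterBlock_nonempty (P := PV d ℓ m K hd hL) (show j + 1 ≤ m + K by omega) (blockOf y)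
      rw [mem_iterBlock] at hx''
      intro hdeep
      have hmem : iterBlockOf (j + 1) x'' ∈ (domT hN D hk).Om (j + 1) := by rw [hx'']; exact hdeep
      have h1 := (iterBlockOf_mem_domT_iff hN D hk (by omega) hjk' x'').1 hmem
      have h2 := hmax x'' (Finset.mem_univ _)
      omega
  -- the two bonds based at y₀ in the directions 0 and 1
  let μ₀ : Fin (d + 1) := ⟨0, by omega⟩
  let μ₁ : Fin (d + 1) := ⟨1, by omega⟩
  let b₀ : PBond (PV d ℓ m K hd hL) j := ⟨y₀, μ₀⟩
  let b₁ : PBond (PV d ℓ m K hd hL) j := ⟨y₀, μ₁⟩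
  have hL₀ : (domT hN D hk).LamBond j b₀ := ⟨Or.inl hOm, hnd _, hnd _⟩
  have hL₁ : (domT hN D hk).LamBond j b₁ := ⟨Or.inl hOm, hnd _, hnd _⟩
  let c' : BondIdx (domT hN D hk) := ⟨⟨⟨j, by show j < k + 1; omega⟩, b₀⟩, hL₀⟩
  let c'' : BondIdx (domT hN D hk) := ⟨⟨⟨j, by show j < k + 1; omega⟩, b₁⟩, hL₁⟩
  have hbase' : base hN D hk c' = y₀ := by
    show (if b₀.src ∈ (domT hN D hk).Om j then b₀.src else b₀.tgt) = y₀
    rw [if_pos hOm]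
  have hbase'' : base hN D hk c'' = y₀ := by
    show (if b₁.src ∈ (domT hN D hk).Om j then b₁.src else b₁.tgt) = y₀
    rw [if_pos hOm]
  have hβ' : blkV1 hN D (⟨xs, μ₀⟩ : PBond (PV d ℓ m K hd hL) 0) = β hN D hk c' :=
    blkV1_eq_beta hN D hk hk1 c' (by rw [hbase'])
  have hβ'' : blkV1 hN D (⟨xs, μ₀⟩ : PBond (PV d ℓ m K hd hL) 0) = β hN D hk c'' :=
    blkV1_eq_beta hN D hk hk1 c'' (by rw [hbase''])
  refine ⟨c', c'', ⟨xs, μ₀⟩, ?_, hβ'.symm.trans hβ'', hβ'⟩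
  intro h
  have hdir : b₀.dir = b₁.dir := by
    have := congrArg (fun c : BondIdx (domT hN D hk) => c.1.2.dir.val) h
    exact Fin.ext this
  have : (μ₀ : Fin (d + 1)) = μ₁ := hdir
  exact absurd (congrArg Fin.val this) (by show (0 : ℕ) ≠ 1; omega)

end Exists

/-! ## §3 ★★ At the record: the binder `CoRealizes ((ops x).GA) 0 1 …` is unsatisfiable at every member (dimension ≥ 2) -/

section Record

open scoped Matrix.Norms.L2Operator

variable (N : ℕ) (θ : Stage3Params) (Mstar : ℕ) (𝔏 : LettersY N θ Mstar) (𝔈 : ExpsY N θ Mstar)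

/-- ★★ **EVERY KNIT BINDER OF THE SHAPE `CoRealizes ((opsYOfLetters N θ M⋆ 𝔏 𝔈) x).GA 0 1 bu bv ev A` IS UNSATISFIABLE** at every member of the
record (`N ≥ 1`, two lattice directions `1 ≤ θ.d₆`), for every letter record `𝔏`, every `𝔈`, every model data `u v bu bv ev A` — §2 supplies the
two index bonds with one carrier block (`KIdx.hk2`: k ≥ 2), §1 the refutation.
[cite: Balaban1985BackgroundPropagators, (3.42) p.397 + Cor. 3.5 p.407; Balaban1984PropagatorsII, (2.3) p.224 + (2.22) p.226 + p.228] -/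
theorem not_hcoGA_opsYOfLetters (hN : 1 ≤ N) (hd : 1 ≤ θ.d₆) (x : MemberY θ.d₆ θ.ℓ₆ θ.hd' θ.hL' θ.b₀ θ.b₁ Mstar)
    {u v : Type} (bu : u → (geo9Y x).Site) (bv : v → (geo9Y x).Site) (ev : (geo9Y x).Loc → v → ℝ) (A : (v → ℝ) →ₗ[ℝ] (u → ℝ)) :
    ¬ CoRealizes ((opsYOfLetters N θ Mstar 𝔏 𝔈) x).GA 0 (bg9Y (Matrix (Fin N) (Fin N) ℂ) (specialUnitaryUnits (Fin N)) x).one bu bv ev A := by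
  haveI : Nonempty (Fin N) := ⟨⟨0, hN⟩⟩
  obtain ⟨c', c'', x₀, hne, hβ, hx₀⟩ := exists_sharedBlock x.hN x.D x.hk hd (le_trans one_le_two x.hk2)
  exact not_coRealizes_GA_one_of_sharedBlock x (𝔏 x) (𝔈 x) hne hβ hx₀ bu bv ev A

/-- ★★ **… IN PARTICULAR AT def-Y's INSTANCE OF RECORD `opsYOfRecord N θ M⋆ 𝔈`** (= `opsYOfLetters` at `lettersYOfRecord`, `Node00.OpsYDeltaA`): the
binder `hcoA0 : ∀ x U, CoRealizes ((opsYOfRecord …) x).GA 0 U …` of the N06 knit FILE 23 (`…N06AtOpsYOfRecordB`) is unsatisfiable at every member.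
[cite: Balaban1985BackgroundPropagators, (3.42) p.397 + Cor. 3.5 p.407; Balaban1984PropagatorsII, (2.3) p.224 + (2.22) p.226 + p.228] -/
theorem not_hcoGA_opsYOfRecord (𝔈' : ExpsY N θ Mstar) (hN : 1 ≤ N) (hd : 1 ≤ θ.d₆) (x : MemberY θ.d₆ θ.ℓ₆ θ.hd' θ.hL' θ.b₀ θ.b₁ Mstar)
    {u v : Type} (bu : u → (geo9Y x).Site) (bv : v → (geo9Y x).Site) (ev : (geo9Y x).Loc → v → ℝ) (A : (v → ℝ) →ₗ[ℝ] (u → ℝ)) :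
    ¬ CoRealizes ((opsYOfRecord N θ Mstar 𝔈') x).GA 0 (bg9Y (Matrix (Fin N) (Fin N) ℂ) (specialUnitaryUnits (Fin N)) x).one bu bv ev A :=
  not_hcoGA_opsYOfLetters N θ Mstar _ 𝔈' hN hd x bu bv ev A

end Record

end Literature.MathematicalPhysics.QuantumFieldTheory.Balaban1983to89.B9CoRealizesSharedBlock

end
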